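import Summits.QuantumFields.YangMills.Theorems.UnitScaleTiltProp7SectET3CombLettersT3
import Summits.QuantumFields.YangMills.Theorems.UnitScaleTiltProp7LaplaceAFlatCoercive
import HarnessLib

/-!
# `UnitScaleTiltProp7LaplaceAcFlatTransfer` — THE FLAT COMB FORM IS FILE B's TUBE∕S FORM WITH ONE SHIFTED SQUARE: `re⟨y, Δ_aᶜ(1) y⟩ = re⟨y, Δ^η(1)y⟩ + ‖R_c(1)D*y‖² +
# a‖Q_kᶜ(1)y‖²`, and **COMB-FLAT COERCIVITY ⟸ (`R_c(1)` has the norm of `R_S(1)`) + (a slice bound `a‖(Q_kᶜ − Q_k)(1)y‖² ≤ ρ·T(y)`)** with the K∕volume-free constant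
# `γ_B∕(2+2ρ)`, `γ_B = 1∕(4·Cst 3 a₀)` (✓`Prop7LaplaceAFlatCoercive.coercive_laplaceA_one`); per-member positivity and the inverse bound likewise
(route `UnitScaleTilt`, crux K1 «MinimiserStabilityRegPr» stmt-QuantumFields-19200; ★★OWNER ym3-torus-plan g29 RULING №17 (2) «COMB-FLAT COERCIVITY — named open flat lemma,
pen px6 g5, LOCATE first»; this file = item (I4) «TRANSFER» of the LOCATE memo `LOCATE-COMBFLAT-px6g5.md` (19200 evidence #60); def-free, count-neutral).
Cell `ym3-torus` (HUMAN RULING D-0037, YM ladder rung R3 — YM₃ on T³ is a rung, not d = 4, not a mass gap, not Clay), width seat `ym3-torus-px6` (gen 5).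

WHAT IS PROVED (sorry-free, no definition, no `Prop`-valued hypothesis other than the displayed rows):
* §1 `re_inner_laplaceAc` — for every background `U₀`, weight `a`, Hessian slot `Δx`: `re⟨y, laplaceAc … a Δx U₀ y⟩ = re⟨y, Δx U₀ y⟩ + ‖Rc U₀ (D*_{U₀} y)‖² + a·‖Qkc U₀ y‖²`
  (✓`Prop7SectET3CombLetters.laplaceAc_eq_laplaceAK` by `rfl`, ✓`adjoint_DL2`, ✓`Rc_isSymmetric`, ✓`Rc_Rc`) — the comb twin of ✓`Prop7LaplaceAFlatCoercive.re_inner_laplaceA`.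
* §2 ★★★ `coercive_laplaceAc_one_of_sliceBound` — at the flat member, for a slot with `Δx 1 = Δ^η(1)`, under the two DISPLAYED rows
  (hR) `∀ u, ‖Rc … 1 u‖ = ‖RS … 1 u‖` and (hv) `∀ y, a·‖Qkc … 1 y − Qk … 1 y‖² ≤ ρ·(re⟨y, Δx 1 y⟩ + ‖RS … 1 (D* y)‖²)` (`0 ≤ ρ`, `a = a₀·(c₀∕cB)·(L^{K−n})³`):
  `(1∕(4·Cst 3 a₀·(2+2ρ)))·‖y‖² ≤ re⟨y, laplaceAc … a Δx 1 y⟩` for ALL `y` — so an L-only `ρ` gives an L-only comb gap.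
* §3 `laplaceAc_one_pos_of` — per-member POSITIVITY `0 < re⟨y, Δ_aᶜ(1) y⟩` (`y ≠ 0`, `n < K`) under (hR) and the row (hker) «`Qkc 1 y = Qk 1 y` whenever `re⟨y, Δx 1 y⟩ = 0`»;
  `norm_GTc_one_le_of` — on the class `PosOntoC … 1`, under (hR), (hv): `‖GTc … 1 f‖ ≤ 4·Cst 3 a₀·(2+2ρ)·‖f‖` (✓`laplaceAc_GTc`).
WHY THESE ROWS (LOCATE memo §§2–5): at `U₀ = 1` the comb averaging is `QTw 1 = L^{K−n}•tube − D̄∘σ` with `σ` blind to fine gradients, so `N_c(1) = N_S(1)`, `Rc 1 = RS 1`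
(row (hR), identity (I1) of the memo) and `Qkc 1 − Qk 1 = −η•toL2B∘D̄∘σ` is controlled by the curl square through a div-free multiscale functional (row (hv), estimate (I3) of
the memo — THE content of [Balaban1985BackgroundPropagators] Thm 3.11's «γ independent of k» for print's comb pair, print-sketchy there).  This file proves neither row; it
reduces COMB-FLAT COERCIVITY to them by six lines of Hilbert-space algebra (`‖u − v‖² ≥ ½‖u‖² − ‖v‖²`-type splitting).
HONEST FRAMING.  (hR), (hv), (hker) displayed, not proved; nothing of HESS ∕ E′ ∕ EX ∕ the crux K1 is proved; rung R3, not Clay; YM gap NOT proved.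
`--supports stmt-QuantumFields-19200 --as helper`.
References: T. Bałaban, CMP 99 (1985) 389–434 [Balaban1985BackgroundPropagators] ((3.26) p.395, Thm 3.11 p.416, (3.115) p.418); CMP 95 (1984) 17–40
[Balaban1984PropagatorsI] (Prop. 1.1 (1.89)–(1.90) p.33); CMP 98 (1985) 17–51 [Balaban1985Averaging] ((81), (85) p.31); CMP 102 (1985) 277–309 [Balaban1985Variational] ((110) p.294).
-/

noncomputable section

open scoped InnerProductSpace ComplexConjugate Matrix.Norms.L2Operator BigOperators

namespace Summit.QuantumFields.YangMills.Theorems.Prop7LaplaceAcFlatTransfer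

open Literature.MathematicalPhysics.QuantumFieldTheory.Balaban1983to89
open Literature.MathematicalPhysics.QuantumFieldTheory.Balaban1983to89.T3ContinuumYM3Torus
open T3SectALandauChart (eta eta_pos)
open LatticeFieldCalculus (curl)
open B9Eq311L2Pairing (WL2)
open B11Eq103H1Complex (SiteL2K BondL2K laplaceAK laplaceAK_apply)
open Summit.QuantumFields.YangMills.Theorems.Prop7SectET3Transport (periodsT3)
open Summit.QuantumFields.YangMills.Theorems.Prop7SectET3HilbertLetters (W₂ toL2 toL2B DL2 DstarL2 adjoint_DL2)
open Summit.QuantumFields.YangMills.Theorems.Prop7SectET3GaugeProjector (RS)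
open Summit.QuantumFields.YangMills.Theorems.Prop7SectET3WilsonHessian (DeltaEta)
open Summit.QuantumFields.YangMills.Theorems.Prop7SectET3CurvedPropagators (Qk laplaceA PosOnto)
open Summit.QuantumFields.YangMills.Theorems.Prop7SectET3CombLetters (Rc Qkc laplaceAc PosOntoC GTc laplaceAc_eq_laplaceAK Rc_isSymmetric Rc_Rc laplaceAc_GTc)
open Summit.QuantumFields.YangMills.Theorems.Prop7LaplaceAFlatLetters (re_inner_DeltaEta_one)
open Summit.QuantumFields.YangMills.Theorems.Prop7LaplaceAFlatCoercive (re_inner_laplaceA coercive_laplaceA_one posOnto_one)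

variable {F : T3Family} {n K : ℕ} {c₀ : ℝ}

/-! ## §1 The three terms of the comb `Δ_a(U₀)` -/

section ThreeSquares

variable [Fact (0 < c₀)]

/-- **`re⟨y, Δ_aᶜ(U₀) y⟩ = re⟨y, Δx(U₀) y⟩ + ‖R_c(U₀) D*_{U₀} y‖² + a·‖Q_kᶜ(U₀) y‖²`** — the comb `Δ_a` ((3.26) with print's comb averaging pair) is lit-balaban's `laplaceAK`
(✓`laplaceAc_eq_laplaceAK`), `D*` is the adjoint of `D` (✓`adjoint_DL2`), `R_c` is an orthogonal projection (✓`Rc_isSymmetric`, ✓`Rc_Rc`).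
[cite: Balaban1985BackgroundPropagators, (3.26) p.395, (3.21) p.394; Balaban1985Variational, (110) p.294] -/
theorem re_inner_laplaceAc {h : n ≤ K} {cB : ℝ} [Fact (0 < cB)] (a : ℝ)
    (Δx : GaugeField (F.P K) 0 (Matrix.specialUnitaryGroup (Fin 2) ℂ) → (BondL2K ℂ 3 (periodsT3 F K) c₀ W₂ →ₗ[ℂ] BondL2K ℂ 3 (periodsT3 F K) c₀ W₂))
    (U₀ : GaugeField (F.P K) 0 (Matrix.specialUnitaryGroup (Fin 2) ℂ)) (y : BondL2K ℂ 3 (periodsT3 F K) c₀ W₂) :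
    RCLike.re ⟪y, laplaceAc F n K h c₀ cB a Δx U₀ y⟫_ℂ
      = RCLike.re ⟪y, Δx U₀ y⟫_ℂ + ‖Rc F n K h c₀ cB U₀ (DstarL2 F n K c₀ U₀ y)‖ ^ 2 + a * ‖Qkc F n K h c₀ cB U₀ y‖ ^ 2 := by
  rw [laplaceAc_eq_laplaceAK, laplaceAK_apply, inner_add_right, inner_add_right, map_add, map_add]
  congr 1
  · congr 1
    -- the gauge penalty: `⟨y, D R D* y⟩ = ⟨D*y, R D*y⟩ = ‖R D*y‖²`
    rw [← LinearMap.adjoint_inner_left, adjoint_DL2]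
    set u := DstarL2 F n K c₀ U₀ y
    have key : ⟪u, Rc F n K h c₀ cB U₀ u⟫_ℂ = ⟪Rc F n K h c₀ cB U₀ u, Rc F n K h c₀ cB U₀ u⟫_ℂ := by
      rw [Rc_isSymmetric U₀ u (Rc F n K h c₀ cB U₀ u), Rc_Rc]
    rw [key]
    exact (norm_sq_eq_re_inner _).symm
  · -- the averaging penalty: `⟨y, Q†(a·Qy)⟩ = a‖Qy‖²`
    rw [LinearMap.adjoint_inner_right, inner_smul_right, norm_sq_eq_re_inner (𝕜 := ℂ) (Qkc F n K h c₀ cB U₀ y)]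
    simp only [RCLike.re_to_complex, Complex.re_ofReal_mul]

/-- At a slot that is `Δ^η(1)` at the flat member, the first term is non-negative: `0 ≤ re⟨y, Δx 1 y⟩` (✓`re_inner_DeltaEta_one`: `c₀·η⁻²·Σ‖curl‖²`).
[cite: Balaban1985BackgroundPropagators, (3.10) p.392] -/
theorem re_inner_slot_one_nonneg
    (Δx : GaugeField (F.P K) 0 (Matrix.specialUnitaryGroup (Fin 2) ℂ) → (BondL2K ℂ 3 (periodsT3 F K) c₀ W₂ →ₗ[ℂ] BondL2K ℂ 3 (periodsT3 F K) c₀ W₂))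
    (hΔ : Δx 1 = (DeltaEta F n K c₀ 1 : BondL2K ℂ 3 (periodsT3 F K) c₀ W₂ →ₗ[ℂ] BondL2K ℂ 3 (periodsT3 F K) c₀ W₂))
    (y : BondL2K ℂ 3 (periodsT3 F K) c₀ W₂) : 0 ≤ RCLike.re ⟪y, Δx 1 y⟫_ℂ := by
  obtain ⟨X, rfl⟩ := (toL2 F K c₀).surjective y
  have hc₀ : 0 < c₀ := Fact.out
  rw [LinearMap.congr_fun hΔ (toL2 F K c₀ X), ContinuousLinearMap.coe_coe, re_inner_DeltaEta_one]
  exact mul_nonneg (mul_nonneg hc₀.le (by positivity)) (by positivity)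

end ThreeSquares

/-! ## §2 ★★★ COMB-FLAT COERCIVITY ⟸ (hR) + (hv): the transfer from FILE B -/

section Transfer

variable [Fact (0 < c₀)]

/-- ★★★ **COMB-FLAT COERCIVITY FROM THE TUBE∕S CERTIFICATE AND TWO DISPLAYED FLAT ROWS.**  At the flat member, for every `a₀ > 0`, every Hessian slot with `Δx 1 = Δ^η(1)`,
if (hR) the comb gauge projection has the norm of the S one (`N_c(1) = N_S(1)`; LOCATE (I1)) and (hv) the shift of the third square is controlled by the first two,
`a‖Q_kᶜ(1)y − Q_k(1)y‖² ≤ ρ·(re⟨y,Δ^η(1)y⟩ + ‖R_S(1)D*y‖²)` (LOCATE (I3); `ρ` is where the K-uniformity lives), then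
`(1∕(4·Cst 3 a₀·(2+2ρ)))·‖y‖² ≤ re⟨y, laplaceAc … (a₀·(c₀∕cB)·(L^{K−n})³) Δx 1 y⟩` for ALL `y`.
Proof: ✓`coercive_laplaceA_one` gives `γ_B‖y‖² ≤ T + a‖u‖²` (`u = Q_k y`, `T` = the two shared squares ≥ 0); with `w = Q_kᶜ y`, `a(‖u‖ − ‖w‖)² ≤ ρT` and
`‖u‖² ≤ 2(‖u‖−‖w‖)² + 2‖w‖²` give `T + a‖u‖² ≤ (2+2ρ)(T + a‖w‖²)`.
[cite: Balaban1985BackgroundPropagators, Thm 3.11 p.416, (3.26) p.395; Balaban1984PropagatorsI, Prop. 1.1 (1.90) p.33] -/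
theorem coercive_laplaceAc_one_of_sliceBound {h : n ≤ K} {cB : ℝ} [Fact (0 < cB)] {a₀ : ℝ} (ha₀ : 0 < a₀)
    (Δx : GaugeField (F.P K) 0 (Matrix.specialUnitaryGroup (Fin 2) ℂ) → (BondL2K ℂ 3 (periodsT3 F K) c₀ W₂ →ₗ[ℂ] BondL2K ℂ 3 (periodsT3 F K) c₀ W₂))
    (hΔ : Δx 1 = (DeltaEta F n K c₀ 1 : BondL2K ℂ 3 (periodsT3 F K) c₀ W₂ →ₗ[ℂ] BondL2K ℂ 3 (periodsT3 F K) c₀ W₂))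
    (hR : ∀ u : SiteL2K ℂ 3 (periodsT3 F K) c₀ W₂,
      ‖Rc F n K h c₀ cB (1 : GaugeField (F.P K) 0 (Matrix.specialUnitaryGroup (Fin 2) ℂ)) u‖
        = ‖RS F n K h c₀ cB (1 : GaugeField (F.P K) 0 (Matrix.specialUnitaryGroup (Fin 2) ℂ)) u‖)
    {ρ : ℝ} (hρ : 0 ≤ ρ)
    (hv : ∀ y : BondL2K ℂ 3 (periodsT3 F K) c₀ W₂,
      (a₀ * (c₀ / cB) * ((F.L : ℝ) ^ (K - n)) ^ 3)
          * ‖Qkc F n K h c₀ cB (1 : GaugeField (F.P K) 0 (Matrix.specialUnitaryGroup (Fin 2) ℂ)) y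
              - Qk F n K h c₀ cB (1 : GaugeField (F.P K) 0 (Matrix.specialUnitaryGroup (Fin 2) ℂ)) y‖ ^ 2
        ≤ ρ * (RCLike.re ⟪y, Δx 1 y⟫_ℂ
              + ‖RS F n K h c₀ cB (1 : GaugeField (F.P K) 0 (Matrix.specialUnitaryGroup (Fin 2) ℂ))
                  (DstarL2 F n K c₀ (1 : GaugeField (F.P K) 0 (Matrix.specialUnitaryGroup (Fin 2) ℂ)) y)‖ ^ 2))
    (y : BondL2K ℂ 3 (periodsT3 F K) c₀ W₂) :
    (1 / (4 * B5Prop11Plancherel.Cst 3 a₀ * (2 + 2 * ρ))) * ‖y‖ ^ 2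
      ≤ RCLike.re ⟪y, laplaceAc F n K h c₀ cB (a₀ * (c₀ / cB) * ((F.L : ℝ) ^ (K - n)) ^ 3) Δx
          (1 : GaugeField (F.P K) 0 (Matrix.specialUnitaryGroup (Fin 2) ℂ)) y⟫_ℂ := by
  have hc₀ : 0 < c₀ := Fact.out
  have hcB : 0 < cB := Fact.out
  have hC : 0 < B5Prop11Plancherel.Cst 3 a₀ := B5Prop11Lattice.Cst_pos (d := 3) (a := a₀)
  -- FILE B at the flat member, in three-square form; the slice row at `y`; the slot is non-negative
  have hB := coercive_laplaceA_one (h := h) (cB := cB) ha₀ Δx hΔ y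
  rw [re_inner_laplaceA] at hB
  have h2 := hv y
  have h0 := re_inner_slot_one_nonneg (n := n) Δx hΔ y
  rw [re_inner_laplaceAc, hR]
  -- letters
  set T : ℝ := RCLike.re ⟪y, Δx 1 y⟫_ℂ
    + ‖RS F n K h c₀ cB (1 : GaugeField (F.P K) 0 (Matrix.specialUnitaryGroup (Fin 2) ℂ))
        (DstarL2 F n K c₀ (1 : GaugeField (F.P K) 0 (Matrix.specialUnitaryGroup (Fin 2) ℂ)) y)‖ ^ 2 with hT_def
  set a : ℝ := a₀ * (c₀ / cB) * ((F.L : ℝ) ^ (K - n)) ^ 3 with ha_def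
  set p : ℝ := ‖Qk F n K h c₀ cB (1 : GaugeField (F.P K) 0 (Matrix.specialUnitaryGroup (Fin 2) ℂ)) y‖ with hp_def
  set w : ℝ := ‖Qkc F n K h c₀ cB (1 : GaugeField (F.P K) 0 (Matrix.specialUnitaryGroup (Fin 2) ℂ)) y‖ with hw_def
  have hT : 0 ≤ T := add_nonneg h0 (by positivity)
  have ha : 0 ≤ a := by positivity
  -- `a(‖w‖ − ‖u‖)² ≤ a‖w − u‖² ≤ ρT`
  have hq : (w - p) ^ 2
      ≤ ‖Qkc F n K h c₀ cB (1 : GaugeField (F.P K) 0 (Matrix.specialUnitaryGroup (Fin 2) ℂ)) y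
          - Qk F n K h c₀ cB (1 : GaugeField (F.P K) 0 (Matrix.specialUnitaryGroup (Fin 2) ℂ)) y‖ ^ 2 := by
    have habs := abs_norm_sub_norm_le
      (Qkc F n K h c₀ cB (1 : GaugeField (F.P K) 0 (Matrix.specialUnitaryGroup (Fin 2) ℂ)) y)
      (Qk F n K h c₀ cB (1 : GaugeField (F.P K) 0 (Matrix.specialUnitaryGroup (Fin 2) ℂ)) y)
    exact sq_le_sq.2 (habs.trans (le_abs_self _))
  have h12 : a * (w - p) ^ 2 ≤ ρ * T := (mul_le_mul_of_nonneg_left hq ha).trans h2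
  -- the splitting `‖u‖² = 2(‖u‖−‖w‖)² + 2‖w‖² − (‖u‖−2‖w‖)²`
  have e1 : a * p ^ 2 = 2 * (a * (w - p) ^ 2) + 2 * (a * w ^ 2) - a * (p - 2 * w) ^ 2 := by ring
  have e2 : (2 + 2 * ρ) * (T + a * w ^ 2) = 2 * T + 2 * (ρ * T) + 2 * (a * w ^ 2) + 2 * (ρ * (a * w ^ 2)) := by ring
  have h3 : T + a * p ^ 2 ≤ (2 + 2 * ρ) * (T + a * w ^ 2) := by
    rw [e2, e1]
    nlinarith [h12, hT, mul_nonneg hρ (mul_nonneg ha (sq_nonneg w)), mul_nonneg ha (sq_nonneg (p - 2 * w)), mul_nonneg hρ hT]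
  have hden : (0 : ℝ) < 2 + 2 * ρ := by positivity
  calc 1 / (4 * B5Prop11Plancherel.Cst 3 a₀ * (2 + 2 * ρ)) * ‖y‖ ^ 2
      = (1 / (4 * B5Prop11Plancherel.Cst 3 a₀) * ‖y‖ ^ 2) / (2 + 2 * ρ) := by
        field_simp
    _ ≤ (T + a * p ^ 2) / (2 + 2 * ρ) := div_le_div_of_nonneg_right hB hden.le
    _ ≤ T + a * w ^ 2 := by
        rw [div_le_iff₀ hden]
        exact h3.trans (le_of_eq (mul_comm _ _))

end Transfer

/-! ## §3 Per-member positivity and the inverse bound under the same rows -/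

section Corollaries

variable [Fact (0 < c₀)]

/-- **PER-MEMBER POSITIVITY OF THE COMB `Δ_a(1)`** (`n < K`): under (hR) and the row (hker) «`Q_kᶜ(1)y = Q_k(1)y` whenever the curl square vanishes» (LOCATE (I1): `σ` kills closed
forms), `0 < re⟨y, Δ_aᶜ(1) y⟩` for `y ≠ 0` — the three comb squares are non-negative, and if all vanish then `Q_k(1)y = 0` too, contradicting ✓`posOnto_one`.
[cite: Balaban1985BackgroundPropagators, Thm 3.11 p.416, (3.26) p.395] -/
theorem laplaceAc_one_pos_of (hnK : n < K) {cB : ℝ} [Fact (0 < cB)] {a₀ : ℝ} (ha₀ : 0 < a₀)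
    (Δx : GaugeField (F.P K) 0 (Matrix.specialUnitaryGroup (Fin 2) ℂ) → (BondL2K ℂ 3 (periodsT3 F K) c₀ W₂ →ₗ[ℂ] BondL2K ℂ 3 (periodsT3 F K) c₀ W₂))
    (hΔ : Δx 1 = (DeltaEta F n K c₀ 1 : BondL2K ℂ 3 (periodsT3 F K) c₀ W₂ →ₗ[ℂ] BondL2K ℂ 3 (periodsT3 F K) c₀ W₂))
    (hR : ∀ u : SiteL2K ℂ 3 (periodsT3 F K) c₀ W₂,
      ‖Rc F n K hnK.le c₀ cB (1 : GaugeField (F.P K) 0 (Matrix.specialUnitaryGroup (Fin 2) ℂ)) u‖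
        = ‖RS F n K hnK.le c₀ cB (1 : GaugeField (F.P K) 0 (Matrix.specialUnitaryGroup (Fin 2) ℂ)) u‖)
    (hker : ∀ y : BondL2K ℂ 3 (periodsT3 F K) c₀ W₂, RCLike.re ⟪y, Δx 1 y⟫_ℂ = 0 →
      Qkc F n K hnK.le c₀ cB (1 : GaugeField (F.P K) 0 (Matrix.specialUnitaryGroup (Fin 2) ℂ)) y
        = Qk F n K hnK.le c₀ cB (1 : GaugeField (F.P K) 0 (Matrix.specialUnitaryGroup (Fin 2) ℂ)) y)
    (y : BondL2K ℂ 3 (periodsT3 F K) c₀ W₂) (hy : y ≠ 0) :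
    0 < RCLike.re ⟪y, laplaceAc F n K hnK.le c₀ cB (a₀ * (c₀ / cB) * ((F.L : ℝ) ^ (K - n)) ^ 3) Δx
          (1 : GaugeField (F.P K) 0 (Matrix.specialUnitaryGroup (Fin 2) ℂ)) y⟫_ℂ := by
  have hc₀ : 0 < c₀ := Fact.out
  have hcB : 0 < cB := Fact.out
  have hL : (0 : ℝ) < F.L := by exact_mod_cast lt_trans zero_lt_one F.hL.2
  have hp := (posOnto_one (c₀ := c₀) hnK (cB := cB) ha₀ Δx hΔ).pos y hy
  rw [re_inner_laplaceA] at hp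
  have h0 := re_inner_slot_one_nonneg (n := n) Δx hΔ y
  rw [re_inner_laplaceAc, hR]
  set a : ℝ := a₀ * (c₀ / cB) * ((F.L : ℝ) ^ (K - n)) ^ 3 with ha_def
  have ha : 0 < a := by positivity
  by_contra hle
  push Not at hle
  have hB0 : 0 ≤ ‖RS F n K hnK.le c₀ cB (1 : GaugeField (F.P K) 0 (Matrix.specialUnitaryGroup (Fin 2) ℂ))
      (DstarL2 F n K c₀ (1 : GaugeField (F.P K) 0 (Matrix.specialUnitaryGroup (Fin 2) ℂ)) y)‖ ^ 2 := by positivity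
  have hC0 : 0 ≤ a * ‖Qkc F n K hnK.le c₀ cB (1 : GaugeField (F.P K) 0 (Matrix.specialUnitaryGroup (Fin 2) ℂ)) y‖ ^ 2 := by positivity
  have hA : RCLike.re ⟪y, Δx 1 y⟫_ℂ = 0 := le_antisymm (by linarith) h0
  have hC : a * ‖Qkc F n K hnK.le c₀ cB (1 : GaugeField (F.P K) 0 (Matrix.specialUnitaryGroup (Fin 2) ℂ)) y‖ ^ 2 = 0 :=
    le_antisymm (by linarith) hC0
  have hw : Qkc F n K hnK.le c₀ cB (1 : GaugeField (F.P K) 0 (Matrix.specialUnitaryGroup (Fin 2) ℂ)) y = 0 := by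
    have := (mul_eq_zero.1 hC).resolve_left ha.ne'
    rwa [sq_eq_zero_iff, norm_eq_zero] at this
  have hu : Qk F n K hnK.le c₀ cB (1 : GaugeField (F.P K) 0 (Matrix.specialUnitaryGroup (Fin 2) ℂ)) y = 0 := by
    rw [← hker y hA, hw]
  have hB : ‖RS F n K hnK.le c₀ cB (1 : GaugeField (F.P K) 0 (Matrix.specialUnitaryGroup (Fin 2) ℂ))
      (DstarL2 F n K c₀ (1 : GaugeField (F.P K) 0 (Matrix.specialUnitaryGroup (Fin 2) ℂ)) y)‖ ^ 2 = 0 :=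
    le_antisymm (by linarith) hB0
  rw [hA, hB, hu, norm_zero] at hp
  norm_num at hp

/-- **THE COMB INVERSE BOUND AT THE FLAT MEMBER** on the class `PosOntoC … 1`, under (hR), (hv): `‖Gᶜ(1) f‖ ≤ 4·Cst 3 a₀·(2+2ρ)·‖f‖` — coercivity `γ‖Gf‖² ≤ re⟨Gf, Δ_aᶜ Gf⟩ =
re⟨Gf, f⟩ ≤ ‖Gf‖‖f‖` (✓`laplaceAc_GTc`). [cite: Balaban1985BackgroundPropagators, Thm 3.4 p.400, Thm 3.11 p.416, (3.27) p.395] -/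
theorem norm_GTc_one_le_of {h : n ≤ K} {cB : ℝ} [Fact (0 < cB)] {a₀ : ℝ} (ha₀ : 0 < a₀)
    (Δx : GaugeField (F.P K) 0 (Matrix.specialUnitaryGroup (Fin 2) ℂ) → (BondL2K ℂ 3 (periodsT3 F K) c₀ W₂ →ₗ[ℂ] BondL2K ℂ 3 (periodsT3 F K) c₀ W₂))
    (hΔ : Δx 1 = (DeltaEta F n K c₀ 1 : BondL2K ℂ 3 (periodsT3 F K) c₀ W₂ →ₗ[ℂ] BondL2K ℂ 3 (periodsT3 F K) c₀ W₂))
    (hP : PosOntoC F n K h c₀ cB (a₀ * (c₀ / cB) * ((F.L : ℝ) ^ (K - n)) ^ 3) Δx (1 : GaugeField (F.P K) 0 (Matrix.specialUnitaryGroup (Fin 2) ℂ)))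
    (hR : ∀ u : SiteL2K ℂ 3 (periodsT3 F K) c₀ W₂,
      ‖Rc F n K h c₀ cB (1 : GaugeField (F.P K) 0 (Matrix.specialUnitaryGroup (Fin 2) ℂ)) u‖
        = ‖RS F n K h c₀ cB (1 : GaugeField (F.P K) 0 (Matrix.specialUnitaryGroup (Fin 2) ℂ)) u‖)
    {ρ : ℝ} (hρ : 0 ≤ ρ)
    (hv : ∀ y : BondL2K ℂ 3 (periodsT3 F K) c₀ W₂,
      (a₀ * (c₀ / cB) * ((F.L : ℝ) ^ (K - n)) ^ 3)
          * ‖Qkc F n K h c₀ cB (1 : GaugeField (F.P K) 0 (Matrix.specialUnitaryGroup (Fin 2) ℂ)) y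
              - Qk F n K h c₀ cB (1 : GaugeField (F.P K) 0 (Matrix.specialUnitaryGroup (Fin 2) ℂ)) y‖ ^ 2
        ≤ ρ * (RCLike.re ⟪y, Δx 1 y⟫_ℂ
              + ‖RS F n K h c₀ cB (1 : GaugeField (F.P K) 0 (Matrix.specialUnitaryGroup (Fin 2) ℂ))
                  (DstarL2 F n K c₀ (1 : GaugeField (F.P K) 0 (Matrix.specialUnitaryGroup (Fin 2) ℂ)) y)‖ ^ 2))
    (f : BondL2K ℂ 3 (periodsT3 F K) c₀ W₂) :
    ‖GTc F n K h c₀ cB (a₀ * (c₀ / cB) * ((F.L : ℝ) ^ (K - n)) ^ 3) Δx (1 : GaugeField (F.P K) 0 (Matrix.specialUnitaryGroup (Fin 2) ℂ)) f‖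
      ≤ 4 * B5Prop11Plancherel.Cst 3 a₀ * (2 + 2 * ρ) * ‖f‖ := by
  set g := GTc F n K h c₀ cB (a₀ * (c₀ / cB) * ((F.L : ℝ) ^ (K - n)) ^ 3) Δx (1 : GaugeField (F.P K) 0 (Matrix.specialUnitaryGroup (Fin 2) ℂ)) f with hg
  have hC : 0 < B5Prop11Plancherel.Cst 3 a₀ := B5Prop11Lattice.Cst_pos (d := 3) (a := a₀)
  have h1 := coercive_laplaceAc_one_of_sliceBound (h := h) (cB := cB) ha₀ Δx hΔ hR hρ hv g
  rw [hg, laplaceAc_GTc hP f, ← hg] at h1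
  have h2 : RCLike.re ⟪g, f⟫_ℂ ≤ ‖g‖ * ‖f‖ := re_inner_le_norm g f
  have h3 : ‖g‖ ^ 2 ≤ 4 * B5Prop11Plancherel.Cst 3 a₀ * (2 + 2 * ρ) * (‖g‖ * ‖f‖) := by
    have := h1.trans h2
    rw [div_mul_eq_mul_div, one_mul, div_le_iff₀ (by positivity)] at this
    linarith
  rcases (norm_nonneg g).eq_or_lt with h0 | hpos
  · rw [← h0]; positivity
  · nlinarith [norm_nonneg f]

end Corollaries

/-! ## §4 (v1.1, APPEND) The transfer CONJUGATED by an isometry — the form in which row (hR) is inhabitable at the route's base point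

LOCATE addendum (F*) «HALF-BLOCK OFFSET» (19200 evidence, memo `LOCATE-COMBFLAT-px6g5.md`; ✓`Prop7CombChartFlatPureGauge.QTw_one_gaugeDir`): at `U₀ = 1` the comb gauge class `N_c(1)` is the
box-averaged class over print's corner-anchored boxes `x̂ + [0,L^{K−n})³`, the S class `N_S(1)` the block-averaged class over the T³ blocks centred at `x̂` — partitions offset by half a block,
so `Rc 1 = τ∘RS 1∘τ⁻¹` for the lattice translation `τ` by `((L^{K−n}−1)∕2)·(1,1,1)` rather than `Rc 1 = RS 1`.  §2 is therefore restated with an isometry `τ` threaded through the rows. -/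

section Conjugated

variable [Fact (0 < c₀)]

/-- ★★★ **COMB-FLAT COERCIVITY FROM THE TUBE∕S CERTIFICATE, CONJUGATED BY AN ISOMETRY `τ`.**  At the flat member, for every `a₀ > 0`, every slot with `Δx 1 = Δ^η(1)`, and every
surjective linear isometry `τ` of the bond space preserving the slot's quadratic form (hτΔ), if (hR) `‖R_c(1)D*(τy)‖ = ‖R_S(1)D*y‖` and (hv) `a‖Q_kᶜ(1)(τy) − Q_k(1)y‖² ≤ ρ·(re⟨y,Δ^η(1)y⟩ +
‖R_S(1)D*y‖²)` for all `y`, then `(1∕(4·Cst 3 a₀·(2+2ρ)))·‖y‖² ≤ re⟨y, laplaceAc … (a₀·(c₀∕cB)·(L^{K−n})³) Δx 1 y⟩` for ALL `y`.  (§2 is the case `τ = id`; the intended `τ` is the half-block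
lattice translation of the LOCATE addendum, under which `N_c(1) = τ·N_S(1)`.)  Same six lines of algebra as §2, at `y = τ y′`.
[cite: Balaban1985BackgroundPropagators, Thm 3.11 p.416, (3.26) p.395, (3.115) p.418; Balaban1984PropagatorsI, Prop. 1.1 (1.90) p.33] -/
theorem coercive_laplaceAc_one_of_sliceBound_conj {h : n ≤ K} {cB : ℝ} [Fact (0 < cB)] {a₀ : ℝ} (ha₀ : 0 < a₀)
    (Δx : GaugeField (F.P K) 0 (Matrix.specialUnitaryGroup (Fin 2) ℂ) → (BondL2K ℂ 3 (periodsT3 F K) c₀ W₂ →ₗ[ℂ] BondL2K ℂ 3 (periodsT3 F K) c₀ W₂))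
    (hΔ : Δx 1 = (DeltaEta F n K c₀ 1 : BondL2K ℂ 3 (periodsT3 F K) c₀ W₂ →ₗ[ℂ] BondL2K ℂ 3 (periodsT3 F K) c₀ W₂))
    (τ : BondL2K ℂ 3 (periodsT3 F K) c₀ W₂ →ₗ[ℂ] BondL2K ℂ 3 (periodsT3 F K) c₀ W₂) (hτn : ∀ y, ‖τ y‖ = ‖y‖) (hτs : Function.Surjective τ)
    (hτΔ : ∀ y, RCLike.re ⟪τ y, Δx 1 (τ y)⟫_ℂ = RCLike.re ⟪y, Δx 1 y⟫_ℂ)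
    (hR : ∀ y : BondL2K ℂ 3 (periodsT3 F K) c₀ W₂,
      ‖Rc F n K h c₀ cB (1 : GaugeField (F.P K) 0 (Matrix.specialUnitaryGroup (Fin 2) ℂ))
          (DstarL2 F n K c₀ (1 : GaugeField (F.P K) 0 (Matrix.specialUnitaryGroup (Fin 2) ℂ)) (τ y))‖
        = ‖RS F n K h c₀ cB (1 : GaugeField (F.P K) 0 (Matrix.specialUnitaryGroup (Fin 2) ℂ))
          (DstarL2 F n K c₀ (1 : GaugeField (F.P K) 0 (Matrix.specialUnitaryGroup (Fin 2) ℂ)) y)‖)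
    {ρ : ℝ} (hρ : 0 ≤ ρ)
    (hv : ∀ y : BondL2K ℂ 3 (periodsT3 F K) c₀ W₂,
      (a₀ * (c₀ / cB) * ((F.L : ℝ) ^ (K - n)) ^ 3)
          * ‖Qkc F n K h c₀ cB (1 : GaugeField (F.P K) 0 (Matrix.specialUnitaryGroup (Fin 2) ℂ)) (τ y)
              - Qk F n K h c₀ cB (1 : GaugeField (F.P K) 0 (Matrix.specialUnitaryGroup (Fin 2) ℂ)) y‖ ^ 2
        ≤ ρ * (RCLike.re ⟪y, Δx 1 y⟫_ℂ
              + ‖RS F n K h c₀ cB (1 : GaugeField (F.P K) 0 (Matrix.specialUnitaryGroup (Fin 2) ℂ))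
                  (DstarL2 F n K c₀ (1 : GaugeField (F.P K) 0 (Matrix.specialUnitaryGroup (Fin 2) ℂ)) y)‖ ^ 2))
    (y : BondL2K ℂ 3 (periodsT3 F K) c₀ W₂) :
    (1 / (4 * B5Prop11Plancherel.Cst 3 a₀ * (2 + 2 * ρ))) * ‖y‖ ^ 2
      ≤ RCLike.re ⟪y, laplaceAc F n K h c₀ cB (a₀ * (c₀ / cB) * ((F.L : ℝ) ^ (K - n)) ^ 3) Δx
          (1 : GaugeField (F.P K) 0 (Matrix.specialUnitaryGroup (Fin 2) ℂ)) y⟫_ℂ := by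
  have hc₀ : 0 < c₀ := Fact.out
  have hcB : 0 < cB := Fact.out
  have hC : 0 < B5Prop11Plancherel.Cst 3 a₀ := B5Prop11Lattice.Cst_pos (d := 3) (a := a₀)
  obtain ⟨y, rfl⟩ := hτs y
  -- FILE B at `y`, in three-square form; the slice row at `y`; the slot is non-negative
  have hB := coercive_laplaceA_one (h := h) (cB := cB) ha₀ Δx hΔ y
  rw [re_inner_laplaceA] at hB
  have h2 := hv y
  have h0 := re_inner_slot_one_nonneg (n := n) Δx hΔ y
  rw [hτn y, re_inner_laplaceAc, hτΔ y, hR y]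
  -- letters
  set T : ℝ := RCLike.re ⟪y, Δx 1 y⟫_ℂ
    + ‖RS F n K h c₀ cB (1 : GaugeField (F.P K) 0 (Matrix.specialUnitaryGroup (Fin 2) ℂ))
        (DstarL2 F n K c₀ (1 : GaugeField (F.P K) 0 (Matrix.specialUnitaryGroup (Fin 2) ℂ)) y)‖ ^ 2 with hT_def
  set a : ℝ := a₀ * (c₀ / cB) * ((F.L : ℝ) ^ (K - n)) ^ 3 with ha_def
  set p : ℝ := ‖Qk F n K h c₀ cB (1 : GaugeField (F.P K) 0 (Matrix.specialUnitaryGroup (Fin 2) ℂ)) y‖ with hp_def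
  set w : ℝ := ‖Qkc F n K h c₀ cB (1 : GaugeField (F.P K) 0 (Matrix.specialUnitaryGroup (Fin 2) ℂ)) (τ y)‖ with hw_def
  have hT : 0 ≤ T := add_nonneg h0 (by positivity)
  have ha : 0 ≤ a := by positivity
  have hq : (w - p) ^ 2
      ≤ ‖Qkc F n K h c₀ cB (1 : GaugeField (F.P K) 0 (Matrix.specialUnitaryGroup (Fin 2) ℂ)) (τ y)
          - Qk F n K h c₀ cB (1 : GaugeField (F.P K) 0 (Matrix.specialUnitaryGroup (Fin 2) ℂ)) y‖ ^ 2 := by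
    have habs := abs_norm_sub_norm_le
      (Qkc F n K h c₀ cB (1 : GaugeField (F.P K) 0 (Matrix.specialUnitaryGroup (Fin 2) ℂ)) (τ y))
      (Qk F n K h c₀ cB (1 : GaugeField (F.P K) 0 (Matrix.specialUnitaryGroup (Fin 2) ℂ)) y)
    exact sq_le_sq.2 (habs.trans (le_abs_self _))
  have h12 : a * (w - p) ^ 2 ≤ ρ * T := (mul_le_mul_of_nonneg_left hq ha).trans h2
  have e1 : a * p ^ 2 = 2 * (a * (w - p) ^ 2) + 2 * (a * w ^ 2) - a * (p - 2 * w) ^ 2 := by ring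
  have e2 : (2 + 2 * ρ) * (T + a * w ^ 2) = 2 * T + 2 * (ρ * T) + 2 * (a * w ^ 2) + 2 * (ρ * (a * w ^ 2)) := by ring
  have h3 : T + a * p ^ 2 ≤ (2 + 2 * ρ) * (T + a * w ^ 2) := by
    rw [e2, e1]
    nlinarith [h12, hT, mul_nonneg hρ (mul_nonneg ha (sq_nonneg w)), mul_nonneg ha (sq_nonneg (p - 2 * w)), mul_nonneg hρ hT]
  have hden : (0 : ℝ) < 2 + 2 * ρ := by positivity
  calc 1 / (4 * B5Prop11Plancherel.Cst 3 a₀ * (2 + 2 * ρ)) * ‖y‖ ^ 2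
      = (1 / (4 * B5Prop11Plancherel.Cst 3 a₀) * ‖y‖ ^ 2) / (2 + 2 * ρ) := by
        field_simp
    _ ≤ (T + a * p ^ 2) / (2 + 2 * ρ) := div_le_div_of_nonneg_right hB hden.le
    _ ≤ T + a * w ^ 2 := by
        rw [div_le_iff₀ hden]
        exact h3.trans (le_of_eq (mul_comm _ _))

end Conjugated

end Summit.QuantumFields.YangMills.Theorems.Prop7LaplaceAcFlatTransfer

end
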